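/-
Copyright (c) 2026 the pub-hodgecm-mathlib formalisation cell (harness21).  Prover seat hodgecm-mathlib-K2E5-p16 (g5): Track B «K2-LIT»,
hLiu418 = stmt-HodgeConjecture-24832, ROAD Φ: THE JUNCTION `K2LiuKFiniteSectionWhittakerHolomorphyGrowth` — the archimedean Whittaker
coefficient of a `K_w`-finite flat section, continued in `s` with three-factor growth in `h` (K2E5-plan (g6) 09:35:45Z (2), LEAD F0P6-plan
(g13) 10:13:40Z «JUNCTION FIRST»); joins K2Liu-p05 (g4)'s ★ (V-4) letter to ★ (7c′)∕(7d) and ★ (E)∕(S); 2026-09-04.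
-/
import Summits.HodgeConjecture.HodgeConjecture.Theorems.K2LiuKFiniteSectionWhittakerAsXiDerivatives   -- ★ (V-4) K2Liu-p05: the letter
import Summits.HodgeConjecture.HodgeConjecture.Theorems.K2LiuHermTwoXiShiftParamGrowthUniform          -- ★ (7c′): uniform jets of `xiShift`
import Summits.HodgeConjecture.HodgeConjecture.Theorems.K2LiuBridgeDirectionLetters                     -- ★ (S): scalar jets, `S(Ξ)` bound
import Summits.HodgeConjecture.HodgeConjecture.Theorems.K2LiuHermTwoXiSeriesLattice                     -- ★ (6a): `one_add_rpow_neg_le_two_mul`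
import Literature.Analysis.FunctionSpaces.BMOCarlesonProofs                                              -- ★ `one_add_pow_le_two_pow_mul`
import HarnessLib

/-!
# Crux `HLiu418`, ROAD Φ — THE JUNCTION: `s ↦ W_h(s; f)` for a `K_w`-finite flat section is holomorphic with three-factor growth in `h`

Cell `hodgecm-mathlib`, crux item hLiu418 = `stmt-HodgeConjecture-24832`, route of record `HCCMUnconditional`; squad K2, LEAD F0P6-plan (g13),
co-dealer K2E5-plan (g7), prover K2E5-p16 (g5); consumer Φ9 (K2Liu-p10 (g3)) via ★ (6a′) `differentiableOn_tsum_prod_of_bounds`.  THEOREMS ONLY;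
lane `--supports stmt-HodgeConjecture-24832 --as helper`.

THE LETTER (★ (V-4) `exists_whittaker_eq_sum_iteratedDeriv_xiShift P k`): for `K_w`-data `P` and weight `k` there are `(J, κ, m, n, s₀)` with, for
every `h > 0`, `re s > s₀` and every flat section `f` of `I_w(s, χ_k)` with `f|_{K_w} = P`,
`W_h(s; f) = Σ_{j∈J} κ_j Σ_{i ≤ e_j} C(e_j, i) · (d∕dτ)^i det(1 + τΞ_j)^{2s + m_j + n_j}|₀ · (d∕dτ)^{e_j − i} xiShift (1 + τΞ_j) h (s+1−k∕2+m_j) (s+1+k∕2+n_j)|₀`,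
`Ξ_j = (√h)⁻¹ Θ_j (√h)⁻¹`.  Call the right-hand side `F h s`.
* `differentiableOn_term` ∕ `norm_term_le` — per `j`: `s ↦` (inner sum) is holomorphic on every open `U ⊆ {0 < re(s + 1 + k∕2)}` (★ (S)
  `differentiable_iteratedDeriv_detPow` × ★ (7c′) `differentiableOn_iteratedDeriv_xiShift_param'`), and on every compact `K` in that half-plane
  it is `≤ C e^{−π tr h} (1 + tr h)^N (1 + det h^{−N′})` with `(C, N, N′)` INDEPENDENT of `h` (★ (S) jets `≤ i! e^{3‖w‖}(8(1+S(Ξ)))^i`, ★ (7c′)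
  `norm_iteratedDeriv_xiShift_param_le_uniform` `≤ C (e−i)! (A(1+S(Ξ)))^{e−i} ×` three factors, ★ (S) `S(Ξ_j) ≤ 4 S(Θ_j) tr h∕det h`, and the
  bookkeeping `(1 + 4T·tr∕det)^e ≤ (2(1+4T))^e (1+tr)^e (1+det^{−e})`, `(1+det^{−a})(1+det^{−b}) ≤ 3(1+det^{−(a+b)})`).
* `kFiniteSection_whittaker_holomorphy_growth` — THE JUNCTION BY NAME: `∃ F s₀` with (i) `∀ h > 0`, `F h` holomorphic on every open
  `U ⊆ {0 < re(s+1+k∕2)}`; (ii) on every compact `K` there, `h`-free `(C, N, N′)` with `‖F h s‖ ≤ C e^{−π tr h}(1+tr h)^N(1+det h^{−N′})` for all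
  `h > 0`, `s ∈ K`; (iii) `F h s = W_h(s; f)` for `re s > s₀` and every flat `K_w`-finite `f` with data `P` — the three faces Φ9 feeds to ★ (6a′).
HONEST LABEL.  Count-neutral helper of the K2_Liu road; it pays no socket by itself: `HC_CM` is proved only modulo the 7 printed citations
(2 remaining named inputs: hLiu418 = `stmt-HodgeConjecture-24832`, h413 = `stmt-HodgeConjecture-24833`) until rung 0 closes.
-/

set_option autoImplicit false
-- the mandated namespace repeats the single-problem summit's segment (`HodgeConjecture.HodgeConjecture`)
set_option linter.dupNamespace false

noncomputable section

open scoped Matrix ComplexConjugate ComplexOrder MatrixOrder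
open Complex Matrix MeasureTheory Set
open Literature.NumberTheory.ModularForms.SiegelUpperHalfSpace (moeb)

namespace Summit.HodgeConjecture.HodgeConjecture.Cruxes.HLiu418.K2LiuKFiniteSectionWhittakerHolomorphyGrowth

open Summit.HodgeConjecture.HodgeConjecture.Cruxes.HLiu418.K2LiuHermTwoGammaDefs
open Summit.HodgeConjecture.HodgeConjecture.Cruxes.HLiu418.K2LiuHermTwoConfluentXiDefs
open Summit.HodgeConjecture.HodgeConjecture.Cruxes.HLiu418.K2LiuHermTwoEtaShiftDefs (xiShift)
open Summit.HodgeConjecture.HodgeConjecture.Cruxes.HLiu418.K2LiuHermTwoXiShiftParamGrowthUniform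
open Summit.HodgeConjecture.HodgeConjecture.Cruxes.HLiu418.K2LiuBridgeDirectionLetters
open Summit.HodgeConjecture.HodgeConjecture.Cruxes.HLiu418.K2LiuKFiniteSectionWhittakerAsXiDerivatives

/-! ## §1 Real bookkeeping -/

/-- `(1 + x^{−a})(1 + x^{−b}) ≤ 3 (1 + x^{−(a+b)})` for `x > 0`, `a, b ≥ 0`. [folklore] -/
theorem one_add_rpow_neg_mul_le {x a b : ℝ} (hx : 0 < x) (ha : 0 ≤ a) (hb : 0 ≤ b) :
    (1 + x ^ (-a)) * (1 + x ^ (-b)) ≤ 3 * (1 + x ^ (-(a + b))) := by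
  have hsingle : ∀ {c : ℝ}, 0 ≤ c → c ≤ a + b → x ^ (-c) ≤ 1 + x ^ (-(a + b)) := by
    intro c hc hcab
    rcases le_or_gt 1 x with h1 | h1
    · have : x ^ (-c) ≤ 1 := Real.rpow_le_one_of_one_le_of_nonpos h1 (by linarith)
      linarith [Real.rpow_nonneg hx.le (-(a + b))]
    · have : x ^ (-c) ≤ x ^ (-(a + b)) := Real.rpow_le_rpow_of_exponent_ge hx h1.le (by linarith)
      linarith
  have hA := hsingle ha (by linarith)
  have hB := hsingle hb (by linarith)
  have hAB : x ^ (-a) * x ^ (-b) = x ^ (-(a + b)) := by rw [← Real.rpow_add hx]; ring_nf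
  nlinarith [Real.rpow_nonneg hx.le (-a), Real.rpow_nonneg hx.le (-b), Real.rpow_nonneg hx.le (-(a + b))]

/-- THE THREE-FACTOR MERGE: for `tr, det > 0`, `N, N′ ≥ 0`, `0 ≤ X ≤ 4T · tr∕det`:
`(1 + X)^e · (1+tr)^N (1 + det^{−N′}) ≤ 3 (2(1+4T))^e · (1+tr)^{N+e} (1 + det^{−(N′+e)})`. [folklore] -/
theorem three_factor_merge {tr dt N N' X T : ℝ} (htr : 0 < tr) (hdt : 0 < dt) (_hN : 0 ≤ N) (hN' : 0 ≤ N') (hX : 0 ≤ X) (hT : 0 ≤ T)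
    (hS : X ≤ 4 * T * (tr / dt)) (e : ℕ) :
    (1 + X) ^ e * ((1 + tr) ^ N * (1 + dt ^ (-N'))) ≤ (3 * (2 * (1 + 4 * T)) ^ e) * ((1 + tr) ^ (N + e) * (1 + dt ^ (-(N' + e)))) := by
  have hdinv : 0 < dt⁻¹ := inv_pos.2 hdt
  -- `1 + X ≤ (1 + 4T)(1 + tr)(1 + det⁻¹)`
  have h1 : 1 + X ≤ (1 + 4 * T) * ((1 + tr) * (1 + dt⁻¹)) := by
    have hR : tr / dt ≤ (1 + tr) * (1 + dt⁻¹) - 1 := by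
      rw [div_eq_mul_inv]
      nlinarith [mul_nonneg htr.le hdinv.le]
    nlinarith [mul_nonneg hT (mul_nonneg htr.le hdinv.le), mul_nonneg hT htr.le, mul_nonneg hT hdinv.le]
  have h2 : (1 + X) ^ e ≤ (1 + 4 * T) ^ e * ((1 + tr) ^ e * (1 + dt⁻¹) ^ e) := by
    rw [← mul_pow, ← mul_pow]; exact pow_le_pow_left₀ (by positivity) h1 e
  have h3 : (1 + dt⁻¹) ^ e ≤ 2 ^ e * (1 + dt ^ (-(e : ℝ))) := by
    have := Literature.Analysis.FunctionSpaces.BMOInv.one_add_pow_le_two_pow_mul hdinv.le e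
    rwa [inv_pow, ← Real.rpow_natCast dt e, ← Real.rpow_neg hdt.le] at this
  have h4 : (1 + dt ^ (-N')) * (1 + dt ^ (-(e : ℝ))) ≤ 3 * (1 + dt ^ (-(N' + e))) := one_add_rpow_neg_mul_le hdt hN' (Nat.cast_nonneg e)
  have h5 : (1 + tr) ^ N * (1 + tr) ^ e = (1 + tr) ^ (N + e) := by
    rw [← Real.rpow_natCast (1 + tr) e, ← Real.rpow_add (by linarith)]
  have hP1 : 0 ≤ (1 + tr) ^ N := Real.rpow_nonneg (by linarith) _
  have hP2 : 0 ≤ 1 + dt ^ (-N') := by linarith [Real.rpow_nonneg hdt.le (-N')]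
  have hP3 : 0 ≤ 1 + dt ^ (-(e : ℝ)) := by linarith [Real.rpow_nonneg hdt.le (-(e : ℝ))]
  calc (1 + X) ^ e * ((1 + tr) ^ N * (1 + dt ^ (-N')))
      ≤ ((1 + 4 * T) ^ e * ((1 + tr) ^ e * (2 ^ e * (1 + dt ^ (-(e : ℝ)))))) * ((1 + tr) ^ N * (1 + dt ^ (-N'))) := by
        refine mul_le_mul_of_nonneg_right (h2.trans (mul_le_mul_of_nonneg_left (mul_le_mul_of_nonneg_left h3 (by positivity))
          (by positivity))) (mul_nonneg hP1 hP2)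
    _ = (2 * (1 + 4 * T)) ^ e * (((1 + tr) ^ N * (1 + tr) ^ e) * ((1 + dt ^ (-N')) * (1 + dt ^ (-(e : ℝ))))) := by rw [mul_pow]; ring
    _ ≤ (2 * (1 + 4 * T)) ^ e * ((1 + tr) ^ (N + e) * (3 * (1 + dt ^ (-(N' + e))))) := by
        rw [h5]
        exact mul_le_mul_of_nonneg_left (mul_le_mul_of_nonneg_left h4 (Real.rpow_nonneg (by linarith) _)) (by positivity)
    _ = (3 * (2 * (1 + 4 * T)) ^ e) * ((1 + tr) ^ (N + e) * (1 + dt ^ (-(N' + e)))) := by ring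

/-! ## §2 One term of the letter: holomorphy -/

/-- `s ↦ (d∕dτ)^n xiShift (1 + τΞ) h (s+1−k∕2+m) (s+1+k∕2+n′)|₀` is holomorphic on every open `U ⊆ {0 < re(s+1+k∕2)}` (★ (7c′)∕(7d) at `g₀ = 1`). -/
theorem differentiableOn_xiJet (Ξ : Matrix (Fin 2) (Fin 2) ℂ) {h : Matrix (Fin 2) (Fin 2) ℂ} (hh : h.PosDef) (k : ℤ) (m n' : ℕ) (N : ℕ)
    {U : Set ℂ} (hU : IsOpen U) (hU0 : ∀ s ∈ U, 0 < (s + 1 + (k : ℂ) / 2).re) :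
    DifferentiableOn ℂ (fun s : ℂ => iteratedDeriv N (fun τ : ℂ => xiShift (1 + τ • Ξ) h (s + 1 - k / 2 + m) (s + 1 + k / 2 + n')) 0) U := by
  have hd : 0 < ((1 : ℝ), (0 : ℂ), (1 : ℝ)).1 ∧ normSq ((1 : ℝ), (0 : ℂ), (1 : ℝ)).2.1 < ((1 : ℝ), (0 : ℂ), (1 : ℝ)).1 * ((1 : ℝ), (0 : ℂ), (1 : ℝ)).2.2 := by
    simp
  have hU0' : ∀ s ∈ U, 0 < ((1 + (k : ℂ) / 2 + n') + 1 * s).re := by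
    intro s hs
    have := hU0 s hs
    simp only [add_re, one_re, one_mul, natCast_re] at this ⊢
    linarith [(Nat.cast_nonneg n' : (0 : ℝ) ≤ n')]
  have h1 := differentiableOn_iteratedDeriv_xiShift_param' hd Ξ hh (1 - (k : ℂ) / 2 + m) (1 + (k : ℂ) / 2 + n') 1 1 hU hU0' N
  have e : (fun s : ℂ => iteratedDeriv N (fun τ : ℂ => xiShift (1 + τ • Ξ) h (s + 1 - k / 2 + m) (s + 1 + k / 2 + n')) 0) =
      fun s : ℂ => iteratedDeriv N (fun t : ℂ => xiShift (hermTwo ((1 : ℝ), (0 : ℂ), (1 : ℝ)) + t • Ξ) h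
        ((1 - (k : ℂ) / 2 + m) + 1 * s) ((1 + (k : ℂ) / 2 + n') + 1 * s)) 0 := by
    funext s
    rw [hermTwo_one_zero_one]
    congr 1
    funext t
    congr 1 <;> ring
  rw [e]
  exact h1

/-- **ONE TERM OF THE LETTER IS HOLOMORPHIC**: for any `Θ`, `h > 0`, `e m n′`, the inner Leibniz sum with `Ξ = (√h)⁻¹ Θ (√h)⁻¹` is holomorphic
in `s` on every open `U ⊆ {0 < re(s + 1 + k∕2)}`. -/
theorem differentiableOn_term (Θ : Matrix (Fin 2) (Fin 2) ℂ) {h : Matrix (Fin 2) (Fin 2) ℂ} (hh : h.PosDef) (k : ℤ) (e m n' : ℕ)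
    {U : Set ℂ} (hU : IsOpen U) (hU0 : ∀ s ∈ U, 0 < (s + 1 + (k : ℂ) / 2).re) :
    DifferentiableOn ℂ (fun s : ℂ => ∑ i ∈ Finset.range (e + 1), ((e.choose i : ℕ) : ℂ) *
      iteratedDeriv i (fun τ : ℂ => (1 + τ • ((CFC.sqrt h)⁻¹ * Θ * (CFC.sqrt h)⁻¹)).det ^ ((s + 1 - k / 2 + m) + (s + 1 + k / 2 + n') - 2)) 0 *
      iteratedDeriv (e - i) (fun τ : ℂ => xiShift (1 + τ • ((CFC.sqrt h)⁻¹ * Θ * (CFC.sqrt h)⁻¹)) h (s + 1 - k / 2 + m) (s + 1 + k / 2 + n')) 0) U := by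
  refine DifferentiableOn.fun_sum fun i _ => ?_
  refine (DifferentiableOn.const_mul ?_ _).mul (differentiableOn_xiJet _ hh k m n' (e - i) hU hU0)
  exact (differentiable_iteratedDeriv_detPow _ (w := fun s : ℂ => (s + 1 - k / 2 + m) + (s + 1 + k / 2 + n') - 2) (by fun_prop) i).differentiableOn

/-! ## §3 One term of the letter: three-factor growth, uniform in `h` -/

/-- **ONE TERM OF THE LETTER HAS `h`-FREE THREE-FACTOR GROWTH** on every compact `K ⊆ {0 < re(s + 1 + k∕2)}`. -/
theorem norm_term_le (Θ : Matrix (Fin 2) (Fin 2) ℂ) (k : ℤ) (e m n' : ℕ) {K : Set ℂ} (hK : IsCompact K)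
    (hK0 : ∀ s ∈ K, 0 < (s + 1 + (k : ℂ) / 2).re) :
    ∃ C N N' : ℝ, 0 ≤ C ∧ 0 ≤ N ∧ 0 ≤ N' ∧ ∀ h : Matrix (Fin 2) (Fin 2) ℂ, h.PosDef → ∀ s ∈ K,
      ‖∑ i ∈ Finset.range (e + 1), ((e.choose i : ℕ) : ℂ) *
        iteratedDeriv i (fun τ : ℂ => (1 + τ • ((CFC.sqrt h)⁻¹ * Θ * (CFC.sqrt h)⁻¹)).det ^ ((s + 1 - k / 2 + m) + (s + 1 + k / 2 + n') - 2)) 0 *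
        iteratedDeriv (e - i) (fun τ : ℂ => xiShift (1 + τ • ((CFC.sqrt h)⁻¹ * Θ * (CFC.sqrt h)⁻¹)) h (s + 1 - k / 2 + m) (s + 1 + k / 2 + n')) 0‖ ≤
      C * Real.exp (-(Real.pi * ((h 0 0).re + (h 1 1).re))) * (1 + ((h 0 0).re + (h 1 1).re)) ^ N *
        (1 + ((h 0 0).re * (h 1 1).re - normSq (h 0 1)) ^ (-N')) := by
  -- the parameter boxes
  have hd : 0 < ((1 : ℝ), (0 : ℂ), (1 : ℝ)).1 ∧ normSq ((1 : ℝ), (0 : ℂ), (1 : ℝ)).2.1 < ((1 : ℝ), (0 : ℂ), (1 : ℝ)).1 * ((1 : ℝ), (0 : ℂ), (1 : ℝ)).2.2 := by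
    simp
  have hKα : IsCompact ((fun s : ℂ => s + 1 - k / 2 + m) '' K) := hK.image (by fun_prop)
  have hLβ : IsCompact ((fun s : ℂ => s + 1 + k / 2 + n') '' K) := hK.image (by fun_prop)
  have hL0 : ∀ β ∈ (fun s : ℂ => s + 1 + (k : ℂ) / 2 + n') '' K, 0 < β.re := by
    rintro β ⟨s, hs, rfl⟩
    have := hK0 s hs
    simp only [add_re, one_re, natCast_re] at this ⊢
    linarith [(Nat.cast_nonneg n' : (0 : ℝ) ≤ n')]
  obtain ⟨C₁, A, N₁, N₁', hC₁, hA, hN₁, hN₁', hB⟩ := norm_iteratedDeriv_xiShift_param_le_uniform hd hKα hLβ hL0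
  -- the exponent of the scalar jets is bounded on `K`
  obtain ⟨W, hW⟩ := hK.exists_bound_of_continuousOn
    ((by fun_prop : Continuous fun s : ℂ => (s + 1 - k / 2 + m) + (s + 1 + k / 2 + n') - 2).continuousOn)
  set T : ℝ := ‖Θ 0 0‖ + ‖Θ 1 0‖ + ‖Θ 0 1‖ + ‖Θ 1 1‖ with hT
  have hT0 : 0 ≤ T := by positivity
  set B₀ : ℝ := max 8 A with hB₀
  have hB₀8 : (8 : ℝ) ≤ B₀ := le_max_left _ _
  have hB₀A : A ≤ B₀ := le_max_right _ _
  have hB₀0 : 0 ≤ B₀ := le_trans (by norm_num) hB₀8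
  -- the constant
  set C₂ : ℝ := ((e + 1 : ℕ) : ℝ) * e.factorial * Real.exp (3 * max W 0) * C₁ * B₀ ^ e with hC₂
  have hC₂0 : 0 ≤ C₂ := by positivity
  refine ⟨C₂ * (3 * (2 * (1 + 4 * T)) ^ e), N₁ + e, N₁' + e, by positivity, by positivity, by positivity, fun h hh s hs => ?_⟩
  -- the letters of `h`
  set Ξ : Matrix (Fin 2) (Fin 2) ℂ := (CFC.sqrt h)⁻¹ * Θ * (CFC.sqrt h)⁻¹ with hΞ
  set S : ℝ := ‖Ξ 0 0‖ + ‖Ξ 1 0‖ + ‖Ξ 0 1‖ + ‖Ξ 1 1‖ with hS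
  have hS0 : 0 ≤ S := by positivity
  set tr : ℝ := (h 0 0).re + (h 1 1).re with htr
  set dt : ℝ := (h 0 0).re * (h 1 1).re - normSq (h 0 1) with hdt
  obtain ⟨c, rfl⟩ : ∃ c : ℝ × ℂ × ℝ, hermTwo c = h := ⟨_, hermTwo_eq_of_isHermitian hh.1⟩
  have hc := (posDef_hermTwo_iff c).mp hh
  have htr0 : 0 < tr := by
    rw [htr]; simp only [hermTwo_apply_zero_zero, hermTwo_apply_one_one, ofReal_re]
    linarith [hc.1, K2LiuHermTwoEtaConvergence.snd_pos_of_cone hc.1 hc.2]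
  have hdt0 : 0 < dt := by
    rw [hdt]; simp only [hermTwo_apply_zero_zero, hermTwo_apply_one_one, hermTwo_apply_zero_one, ofReal_re]; linarith [hc.2]
  have hSle : S ≤ 4 * T * (tr / dt) := entrySum_bridgeDir_le hh Θ
  -- the three-factor envelope at `g₀ = 1`
  set E : ℝ := Real.exp (-(Real.pi * tr)) * (1 + tr) ^ N₁ * (1 + dt ^ (-N₁')) with hE
  have hE0 : 0 ≤ E := by have := Real.rpow_nonneg hdt0.le (-N₁'); positivity
  have htrace : ((hermTwo c * hermTwo ((1 : ℝ), (0 : ℂ), (1 : ℝ))).trace).re = tr := by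
    rw [hermTwo_one_zero_one, Matrix.mul_one, trace_fin_two, add_re]
  -- (a) the `xiShift` jets
  have hxi : ∀ i : ℕ, ‖iteratedDeriv (e - i) (fun τ : ℂ => xiShift (1 + τ • Ξ) (hermTwo c) (s + 1 - k / 2 + m) (s + 1 + k / 2 + n')) 0‖ ≤
      C₁ * (e - i).factorial * (A * (1 + S)) ^ (e - i) * E := by
    intro i
    have h1 := hB Ξ (hermTwo c) hh (s + 1 - k / 2 + m) ⟨s, hs, rfl⟩ (s + 1 + k / 2 + n') ⟨s, hs, rfl⟩ (e - i)
    rw [htrace, hermTwo_one_zero_one] at h1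
    exact h1
  -- (b) the scalar jets
  have hsc : ∀ i : ℕ, ‖iteratedDeriv i (fun τ : ℂ => (1 + τ • Ξ).det ^ ((s + 1 - k / 2 + m) + (s + 1 + k / 2 + n') - 2)) 0‖ ≤
      i.factorial * Real.exp (3 * max W 0) * (8 * (1 + S)) ^ i := by
    intro i
    refine (norm_iteratedDeriv_detPow_le Ξ _ i).trans ?_
    have hw : ‖(s + 1 - (k : ℂ) / 2 + m) + (s + 1 + k / 2 + n') - 2‖ ≤ max W 0 := (hW s hs).trans (le_max_left _ _)
    exact mul_le_mul_of_nonneg_right (mul_le_mul_of_nonneg_left (Real.exp_le_exp.mpr (by linarith)) (by positivity)) (by positivity)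
  -- (c) each Leibniz term
  have hterm : ∀ i ∈ Finset.range (e + 1),
      ‖((e.choose i : ℕ) : ℂ) *
        iteratedDeriv i (fun τ : ℂ => (1 + τ • Ξ).det ^ ((s + 1 - k / 2 + m) + (s + 1 + k / 2 + n') - 2)) 0 *
        iteratedDeriv (e - i) (fun τ : ℂ => xiShift (1 + τ • Ξ) (hermTwo c) (s + 1 - k / 2 + m) (s + 1 + k / 2 + n')) 0‖ ≤
      e.factorial * Real.exp (3 * max W 0) * C₁ * B₀ ^ e * (1 + S) ^ e * E := by
    intro i hi
    have hie : i ≤ e := Nat.lt_succ_iff.mp (Finset.mem_range.mp hi)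
    rw [norm_mul, norm_mul, Complex.norm_natCast]
    have hpow : (8 * (1 + S)) ^ i * (A * (1 + S)) ^ (e - i) ≤ B₀ ^ e * (1 + S) ^ e := by
      rw [mul_pow, mul_pow, show B₀ ^ e * (1 + S) ^ e = (B₀ ^ i * B₀ ^ (e - i)) * ((1 + S) ^ i * (1 + S) ^ (e - i)) by
        rw [← pow_add, ← pow_add, Nat.add_sub_cancel' hie]]
      have h8 : (8 : ℝ) ^ i ≤ B₀ ^ i := pow_le_pow_left₀ (by norm_num) hB₀8 i
      have hAe : A ^ (e - i) ≤ B₀ ^ (e - i) := pow_le_pow_left₀ hA.le hB₀A (e - i)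
      have := mul_le_mul h8 hAe (by positivity) (by positivity)
      nlinarith [pow_nonneg (show (0:ℝ) ≤ 1 + S by positivity) i, pow_nonneg (show (0:ℝ) ≤ 1 + S by positivity) (e - i),
        mul_nonneg (pow_nonneg (show (0:ℝ) ≤ 1 + S by positivity) i) (pow_nonneg (show (0:ℝ) ≤ 1 + S by positivity) (e - i))]
    have hfact : ((e.choose i : ℕ) : ℝ) * (i.factorial * (e - i).factorial) = e.factorial := by
      rw [← mul_assoc]
      exact_mod_cast Nat.choose_mul_factorial_mul_factorial hie
    calc ((e.choose i : ℕ) : ℝ) * ‖iteratedDeriv i (fun τ : ℂ => (1 + τ • Ξ).det ^ ((s + 1 - k / 2 + m) + (s + 1 + k / 2 + n') - 2)) 0‖ *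
          ‖iteratedDeriv (e - i) (fun τ : ℂ => xiShift (1 + τ • Ξ) (hermTwo c) (s + 1 - k / 2 + m) (s + 1 + k / 2 + n')) 0‖
        ≤ ((e.choose i : ℕ) : ℝ) * (i.factorial * Real.exp (3 * max W 0) * (8 * (1 + S)) ^ i) *
            (C₁ * (e - i).factorial * (A * (1 + S)) ^ (e - i) * E) :=
          mul_le_mul (mul_le_mul_of_nonneg_left (hsc i) (by positivity)) (hxi i) (norm_nonneg _) (by positivity)
      _ = (((e.choose i : ℕ) : ℝ) * (i.factorial * (e - i).factorial)) * Real.exp (3 * max W 0) * C₁ *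
            ((8 * (1 + S)) ^ i * (A * (1 + S)) ^ (e - i)) * E := by ring
      _ ≤ e.factorial * Real.exp (3 * max W 0) * C₁ * (B₀ ^ e * (1 + S) ^ e) * E := by
          rw [hfact]
          exact mul_le_mul_of_nonneg_right (mul_le_mul_of_nonneg_left hpow (by positivity)) hE0
      _ = e.factorial * Real.exp (3 * max W 0) * C₁ * B₀ ^ e * (1 + S) ^ e * E := by ring
  -- (d) sum and merge
  have hsum := (norm_sum_le _ _).trans (Finset.sum_le_sum hterm)
  rw [Finset.sum_const, Finset.card_range, nsmul_eq_mul] at hsum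
  refine hsum.trans ?_
  have hmerge := three_factor_merge htr0 hdt0 hN₁ hN₁' hS0 hT0 hSle e
  calc ((e + 1 : ℕ) : ℝ) * (e.factorial * Real.exp (3 * max W 0) * C₁ * B₀ ^ e * (1 + S) ^ e * E)
      = C₂ * ((1 + S) ^ e * ((1 + tr) ^ N₁ * (1 + dt ^ (-N₁')))) * Real.exp (-(Real.pi * tr)) := by rw [hC₂, hE]; push_cast; ring
    _ ≤ C₂ * ((3 * (2 * (1 + 4 * T)) ^ e) * ((1 + tr) ^ (N₁ + e) * (1 + dt ^ (-(N₁' + e))))) * Real.exp (-(Real.pi * tr)) :=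
        mul_le_mul_of_nonneg_right (mul_le_mul_of_nonneg_left hmerge hC₂0) (Real.exp_pos _).le
    _ = C₂ * (3 * (2 * (1 + 4 * T)) ^ e) * Real.exp (-(Real.pi * tr)) * (1 + tr) ^ (N₁ + e) * (1 + dt ^ (-(N₁' + e))) := by ring

/-! ## §4 The junction by name -/

/-- **THE JUNCTION `K2LiuKFiniteSectionWhittakerHolomorphyGrowth`.**  For `K_w`-data `P` and weight `k` there are `F : (h) → (s) → ℂ` and `s₀` with:
(i) for every `h > 0`, `F h` is holomorphic on every open `U ⊆ {0 < re(s + 1 + k∕2)}`; (ii) on every compact `K` in that half-plane there are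
`h`-FREE `C, N, N′ ≥ 0` with `‖F h s‖ ≤ C e^{−π tr h}(1 + tr h)^N (1 + det h^{−N′})` for all `h > 0`, `s ∈ K`; (iii) for `re s > s₀`, every `h > 0`
and every flat section `f` of `I_w(s, χ_k)` with `f|_{K_w} = P`, the Whittaker integral `W_h(s; f) = ∫ f(J n(x)) e(−tr(hx)) dx` equals `F h s`.
`F` is K2Liu-p05 (g4)'s ★ (V-4) letter; (i) by ★ (7d)∕(S), (ii) by ★ (7c′)∕(S). [cite: Shimura1997, §16.4] -/
theorem kFiniteSection_whittaker_holomorphy_growth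
    (P : MvPolynomial (((Fin 2 ⊕ Fin 2) × (Fin 2 ⊕ Fin 2)) ⊕ ((Fin 2 ⊕ Fin 2) × (Fin 2 ⊕ Fin 2))) ℂ) (k : ℤ) :
    ∃ (F : Matrix (Fin 2) (Fin 2) ℂ → ℂ → ℂ) (s₀ : ℝ),
      (∀ {U : Set ℂ}, IsOpen U → (∀ s ∈ U, 0 < (s + 1 + (k : ℂ) / 2).re) →
        ∀ {h : Matrix (Fin 2) (Fin 2) ℂ}, h.PosDef → DifferentiableOn ℂ (F h) U) ∧
      (∀ {K : Set ℂ}, IsCompact K → (∀ s ∈ K, 0 < (s + 1 + (k : ℂ) / 2).re) →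
        ∃ C N N' : ℝ, 0 ≤ C ∧ 0 ≤ N ∧ 0 ≤ N' ∧ ∀ h : Matrix (Fin 2) (Fin 2) ℂ, h.PosDef → ∀ s ∈ K,
          ‖F h s‖ ≤ C * Real.exp (-(Real.pi * ((h 0 0).re + (h 1 1).re))) * (1 + ((h 0 0).re + (h 1 1).re)) ^ N *
            (1 + ((h 0 0).re * (h 1 1).re - normSq (h 0 1)) ^ (-N'))) ∧
      (∀ (h : Matrix (Fin 2) (Fin 2) ℂ), h.PosDef → ∀ (s : ℂ), s₀ < s.re → ∀ (f : Matrix (Fin 2 ⊕ Fin 2) (Fin 2 ⊕ Fin 2) ℂ → ℂ),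
        K2LiuArchInducedTubeDefs.IsArchSiegelSection (fun z : ℂ => (conj z / ((‖z‖ : ℝ) : ℂ)) ^ k) s f →
        (∀ u : Matrix (Fin 2 ⊕ Fin 2) (Fin 2 ⊕ Fin 2) ℂ, uᴴ * Matrix.J (Fin 2) ℂ * u = Matrix.J (Fin 2) ℂ → moeb u (I • (1 : Matrix (Fin 2) (Fin 2) ℂ)) = I • 1 →
          f u = MvPolynomial.eval (Sum.elim (fun pq => u pq.1 pq.2) (fun pq => conj (u pq.1 pq.2))) P) →
        ∫ c : ℝ × ℂ × ℝ, f (Matrix.J (Fin 2) ℂ * fromBlocks 1 (hermTwo c) 0 1) * cexp (-(2 * Real.pi * I) * (h * hermTwo c).trace) = F h s) := by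
  obtain ⟨J, κ, m, n, s₀, hW⟩ := exists_whittaker_eq_sum_iteratedDeriv_xiShift P k
  refine ⟨fun h s => ∑ j ∈ J, κ j * ∑ i ∈ Finset.range (j.2.2 + 1), ((j.2.2.choose i : ℕ) : ℂ) *
      iteratedDeriv i (fun τ : ℂ => (1 + τ • ((CFC.sqrt h)⁻¹ * (j.2.1 : Matrix (Fin 2) (Fin 2) ℂ) * (CFC.sqrt h)⁻¹)).det ^
        ((s + 1 - k / 2 + m j) + (s + 1 + k / 2 + n j) - 2)) 0 *
      iteratedDeriv (j.2.2 - i) (fun τ : ℂ => xiShift (1 + τ • ((CFC.sqrt h)⁻¹ * (j.2.1 : Matrix (Fin 2) (Fin 2) ℂ) * (CFC.sqrt h)⁻¹)) h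
        (s + 1 - k / 2 + m j) (s + 1 + k / 2 + n j)) 0, s₀, ?_, ?_, fun h hh s hs f hf hP => hW h hh s hs f hf hP⟩
  · -- (i) holomorphy
    intro U hU hU0 h hh
    exact DifferentiableOn.fun_sum fun j _ => (differentiableOn_term (j.2.1 : Matrix (Fin 2) (Fin 2) ℂ) hh k j.2.2 (m j) (n j) hU hU0).const_mul _
  · -- (ii) growth: sum the per-term bounds over `J`
    intro K hK hK0
    choose C N N' hC hN hN' hB using fun j : (Σ _ : ((Fin 2 × Fin 2) ⊕ (Fin 2 × Fin 2)) →₀ ℕ,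
      {M : Matrix (Fin 2) (Fin 2) ℂ // M.IsHermitian} × ℕ) => norm_term_le (j.2.1 : Matrix (Fin 2) (Fin 2) ℂ) k j.2.2 (m j) (n j) hK hK0
    set Nm : ℝ := ∑ j ∈ J, N j with hNm
    set Nm' : ℝ := ∑ j ∈ J, N' j with hNm'
    have hNm0 : 0 ≤ Nm := Finset.sum_nonneg fun j _ => hN j
    have hNm'0 : 0 ≤ Nm' := Finset.sum_nonneg fun j _ => hN' j
    have hNle : ∀ j ∈ J, N j ≤ Nm := fun j hj => Finset.single_le_sum (f := N) (fun i _ => hN i) hj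
    have hN'le : ∀ j ∈ J, N' j ≤ Nm' := fun j hj => Finset.single_le_sum (f := N') (fun i _ => hN' i) hj
    refine ⟨∑ j ∈ J, ‖κ j‖ * (2 * C j), Nm, Nm', Finset.sum_nonneg fun j _ => mul_nonneg (norm_nonneg _) (by linarith [hC j]), hNm0, hNm'0,
      fun h hh s hs => ?_⟩
    have htr0 : 0 < (h 0 0).re + (h 1 1).re := K2LiuHermTwoXiSeries.trace_re_pos_of_posDef hh
    have hdt0 : 0 < (h 0 0).re * (h 1 1).re - normSq (h 0 1) := K2LiuHermTwoConfluentXiRegularity.det_re_pos_of_posDef hh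
    refine (norm_sum_le _ _).trans ?_
    rw [Finset.sum_mul, Finset.sum_mul, Finset.sum_mul]
    refine Finset.sum_le_sum fun j hj => ?_
    rw [norm_mul]
    have h1 := hB j h hh s hs
    have e1 : (1 + ((h 0 0).re + (h 1 1).re)) ^ N j ≤ (1 + ((h 0 0).re + (h 1 1).re)) ^ Nm :=
      Real.rpow_le_rpow_of_exponent_le (by linarith) (hNle j hj)
    have e2 : 1 + ((h 0 0).re * (h 1 1).re - normSq (h 0 1)) ^ (-N' j) ≤ 2 * (1 + ((h 0 0).re * (h 1 1).re - normSq (h 0 1)) ^ (-Nm')) :=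
      K2LiuHermTwoXiSeriesLattice.one_add_rpow_neg_le_two_mul hdt0 (hN' j) (hN'le j hj)
    have hCe : 0 ≤ C j * Real.exp (-(Real.pi * ((h 0 0).re + (h 1 1).re))) := mul_nonneg (hC j) (Real.exp_pos _).le
    have h2 := h1.trans (mul_le_mul (mul_le_mul_of_nonneg_left e1 hCe) e2
      (by linarith [Real.rpow_nonneg hdt0.le (-N' j)]) (mul_nonneg hCe (Real.rpow_nonneg (by linarith) _)))
    calc ‖κ j‖ * ‖_‖ ≤ ‖κ j‖ * (C j * Real.exp (-(Real.pi * ((h 0 0).re + (h 1 1).re))) * (1 + ((h 0 0).re + (h 1 1).re)) ^ Nm *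
          (2 * (1 + ((h 0 0).re * (h 1 1).re - normSq (h 0 1)) ^ (-Nm')))) := mul_le_mul_of_nonneg_left h2 (norm_nonneg _)
      _ = ‖κ j‖ * (2 * C j) * Real.exp (-(Real.pi * ((h 0 0).re + (h 1 1).re))) * (1 + ((h 0 0).re + (h 1 1).re)) ^ Nm *
          (1 + ((h 0 0).re * (h 1 1).re - normSq (h 0 1)) ^ (-Nm')) := by ring

end Summit.HodgeConjecture.HodgeConjecture.Cruxes.HLiu418.K2LiuKFiniteSectionWhittakerHolomorphyGrowth

end
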